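import Literature.NumberTheory.GaloisRepresentations.ContinuousCupProductCompat
import Literature.NumberTheory.GaloisRepresentations.PPrimaryDevissage
import Literature.NumberTheory.GaloisRepresentations.LocalGlobalCohomologyDualityProofs
import HarnessLib

/-!
# The dual `Hom(M, Ω)` of a finite discrete module and its evaluation pairing

For a topological group `G`, a *finite* discrete `G`-module `M` and a discrete `G`-module `Ω`
(the tree's `ContinuousRep G ℤ _`), this file sets up the dual module

  `M^D = Hom(M, Ω)`, `(σ f)(m) = σ f(σ⁻¹ m)`

(`ContinuousRep.homRep`; Milne, *Arithmetic Duality Theorems*, I §0 "`G` acts on `Hom(M, N)` by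
`(σf)(m) = σ(f(σ⁻¹m))`"; Serre, *Cohomologie galoisienne*, II §5.1, `A' = Hom(A, μ)`), generalising
the tree's Tate dual `DiscreteGaloisModule.tateDual` (`= homRep` for `G = Γ_K`, `Ω = μₙ(K̄)`:
`DiscreteGaloisModule.tateDual_apply_eq_homRep_apply`) to arbitrary groups, as needed over the
closed subgroups `Γ_E ≤ Γ_F` in the dévissage proof of local Tate duality.  Contents:

* `HomCarrier M Ω` (the discrete abelian group `M →+ Ω`), `ContinuousRep.homRep`
  (continuity: the stabiliser of `f` contains `⋂ₘ Stab(m) ∩ Stab(f m)`), its restriction along a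
  continuous homomorphism (`homRep_restrict`);
* contravariant functoriality `ContinuousRep.homRepMap φ : M₂^D ⟶ M₁^D`, `f ↦ f ∘ φ`;
* the **evaluation pairing** `M × M^D → Ω` (`ContinuousRep.evalPairing`, a `ContPairing`) and its
  compatibility with `homRepMap` (`evalPairing_homRepMap`: `⟨φ m₁, f⟩ = ⟨m₁, f ∘ φ⟩`);
* the **dual short exact sequence** of `0 → N → M → M/N → 0` for a stable submodule `N`:
  `0 → (M/N)^D → M^D → N^D → 0` (`isSES_homRepMap_mkQ_subtype`), whose only non-formal point,
  the surjectivity of restriction `Hom(M, Ω) → Hom(N, Ω)`, holds when `Ω ≃ ℤ/n` and `n M = 0` by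
  counting (`|Hom(A, ℤ/n)| = |A|`, the tree's `Nat.card_addMonoidHom_zmod`): `ℤ/n` is an
  injective `ℤ/n`-module.

## References

* J. S. Milne, *Arithmetic Duality Theorems*, 2nd ed. (2006), I §0 (pairings, `Hom(M, N)` as a
  `G`-module), I §2. [MilneADT2006]
* J.-P. Serre, *Cohomologie galoisienne* (1994/1997), II §5.1–5.2. [SerreGaloisCohomology1997]
-/

noncomputable section

open CategoryTheory Limits Function Topology

universe u v w

namespace Literature.NumberTheory.GaloisRepresentations

open _root_.TopRep _root_.ContRepresentation _root_.ContinuousCohomology _root_.Topology _root_.Filter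

/-! ### The carrier `Hom(M, Ω)` -/

/-- The abelian group `Hom(M, Ω)` of additive maps, as a type synonym carrying the **discrete**
topology (cf. the tree's `DiscreteGaloisModule.TateDual K M n = HomCarrier M μₙ(K̄)`).
[cite: MilneADT2006, I §0] -/
def HomCarrier (M : Type v) (Ω : Type w) [AddCommGroup M] [AddCommGroup Ω] : Type (max v w) :=
  M →+ Ω

namespace HomCarrier

variable {M : Type v} {Ω : Type w} [AddCommGroup M] [AddCommGroup Ω]

/-- `Hom(M, Ω)` is an abelian group (pointwise). [folklore] -/
instance instAddCommGroup : AddCommGroup (HomCarrier M Ω) := inferInstanceAs (AddCommGroup (M →+ Ω))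

/-- Elements of `Hom(M, Ω)` are functions. [folklore] -/
instance instFunLike : FunLike (HomCarrier M Ω) M Ω := inferInstanceAs (FunLike (M →+ Ω) M Ω)

/-- Elements of `Hom(M, Ω)` are additive homomorphisms. [folklore] -/
instance instAddMonoidHomClass : AddMonoidHomClass (HomCarrier M Ω) M Ω :=
  inferInstanceAs (AddMonoidHomClass (M →+ Ω) M Ω)

/-- The discrete topology on `Hom(M, Ω)`. [folklore] -/
instance instTopologicalSpace : TopologicalSpace (HomCarrier M Ω) := ⊥

/-- The topology on `Hom(M, Ω)` is discrete by definition. [folklore] -/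
instance instDiscreteTopology : DiscreteTopology (HomCarrier M Ω) := ⟨rfl⟩

/-- Extensionality. [folklore] -/
@[ext] theorem ext {f g : HomCarrier M Ω} (h : ∀ m, f m = g m) : f = g := DFunLike.ext f g h

/-- An additive map as an element of `HomCarrier`. [folklore] -/
def ofAddMonoidHom (f : M →+ Ω) : HomCarrier M Ω := f

/-- Unfolding `ofAddMonoidHom`. [folklore] -/
@[simp] theorem ofAddMonoidHom_apply (f : M →+ Ω) (m : M) : ofAddMonoidHom f m = f m := rfl

/-- Pointwise addition. [folklore] -/
@[simp] theorem add_apply (f g : HomCarrier M Ω) (m : M) : (f + g) m = f m + g m := rfl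

/-- Pointwise zero. [folklore] -/
@[simp] theorem zero_apply (m : M) : (0 : HomCarrier M Ω) m = 0 := rfl

/-- Pointwise negation. [folklore] -/
@[simp] theorem neg_apply (f : HomCarrier M Ω) (m : M) : (-f) m = -f m := rfl

/-- Pointwise subtraction. [folklore] -/
@[simp] theorem sub_apply (f g : HomCarrier M Ω) (m : M) : (f - g) m = f m - g m := rfl

/-- Pointwise scalar multiplication by naturals. [folklore] -/
@[simp] theorem nsmul_apply (k : ℕ) (f : HomCarrier M Ω) (m : M) : (k • f) m = k • f m := rfl

/-- Pointwise scalar multiplication by integers. [folklore] -/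
@[simp] theorem zsmul_apply (k : ℤ) (f : HomCarrier M Ω) (m : M) : (k • f) m = k • f m := rfl

/-- `Hom(M, Ω)` is finite for finite `M`, `Ω`. [folklore] -/
instance instFinite [Finite M] [Finite Ω] : Finite (HomCarrier M Ω) :=
  .of_injective _ DFunLike.coe_injective

/-- `Hom(M, Ω)` is killed by `n` if `M` is. [folklore] -/
theorem nsmul_eq_zero_of_left {n : ℕ} (hM : ∀ m : M, n • m = 0) (f : HomCarrier M Ω) :
    n • f = 0 :=
  ext fun m => by rw [nsmul_apply, ← map_nsmul, hM, map_zero, zero_apply]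

/-- **`|Hom(A, Ω)| = |A|`** for finite `A` killed by `n` and `Ω ≃ ℤ/n` (the tree's
`Nat.card_addMonoidHom_zmod`, transported along `Ω ≃+ ℤ/n`). [folklore] -/
theorem natCard_eq {n : ℕ} [NeZero n] [Finite M] (eΩ : Ω ≃+ ZMod n) (hM : ∀ m : M, n • m = 0) :
    Nat.card (HomCarrier M Ω) = Nat.card M := by
  rw [← Nat.card_addMonoidHom_zmod hM]
  exact Nat.card_congr
    { toFun := fun f => eΩ.toAddMonoidHom.comp (f : M →+ Ω)
      invFun := fun g => ofAddMonoidHom (eΩ.symm.toAddMonoidHom.comp g)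
      left_inv := fun f => ext fun m => eΩ.symm_apply_apply _
      right_inv := fun g => AddMonoidHom.ext fun m => eΩ.apply_symm_apply _ }

end HomCarrier

/-! ### The dual module `M^D = Hom(M, Ω)` -/

namespace ContinuousRep

section HomRep

variable {G : Type u} [Group G] [TopologicalSpace G]
variable {M : Type u} [AddCommGroup M] [TopologicalSpace M] [DiscreteTopology M]
variable {Ω : Type u} [AddCommGroup Ω] [TopologicalSpace Ω] [DiscreteTopology Ω]
variable (ρ : ContinuousRep G ℤ M) (ω : ContinuousRep G ℤ Ω)

/-- The action of `σ` on `Hom(M, Ω)`, `f ↦ σ ∘ f ∘ ρ(σ⁻¹)`, as an additive endomorphism.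
[cite: MilneADT2006, I §0] -/
def homEnd (σ : G) : HomCarrier M Ω →+ HomCarrier M Ω where
  toFun f := HomCarrier.ofAddMonoidHom
    ((ω σ).toAddMonoidHom.comp ((f : M →+ Ω).comp (ρ σ⁻¹).toAddMonoidHom))
  map_zero' := HomCarrier.ext fun _ => map_zero (ω σ)
  map_add' _ _ := HomCarrier.ext fun _ => map_add (ω σ) _ _

omit [DiscreteTopology M] [DiscreteTopology Ω] in
/-- Unfolding `homEnd`. [folklore] -/
@[simp] theorem homEnd_apply_apply (σ : G) (f : HomCarrier M Ω) (m : M) :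
    homEnd ρ ω σ f m = ω σ (f (ρ σ⁻¹ m)) := rfl

/-- The representation `σ ↦ (f ↦ σ ∘ f ∘ ρ(σ⁻¹))` of `G` on `Hom(M, Ω)`.
[cite: MilneADT2006, I §0] -/
def homRepresentation : Representation ℤ G (HomCarrier M Ω) where
  toFun σ := (homEnd ρ ω σ).toIntLinearMap
  map_one' := by
    refine LinearMap.ext fun f => HomCarrier.ext fun m => ?_
    simp
  map_mul' σ τ := by
    refine LinearMap.ext fun f => HomCarrier.ext fun m => ?_
    simp only [AddMonoidHom.coe_toIntLinearMap, Module.End.mul_apply, homEnd_apply_apply,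
      mul_inv_rev, _root_.map_mul, Module.End.mul_apply]

omit [DiscreteTopology M] [DiscreteTopology Ω] in
/-- Unfolding `homRepresentation`. [folklore] -/
@[simp] theorem homRepresentation_apply_apply_apply (σ : G) (f : HomCarrier M Ω) (m : M) :
    homRepresentation ρ ω σ f m = ω σ (f (ρ σ⁻¹ m)) := rfl

variable [ContinuousMul G] [Finite M]

/-- **The dual `M^D = Hom(M, Ω)` of a finite discrete module `M`** with values in a discrete
module `Ω`, `(σ f)(m) = σ f(σ⁻¹ m)`; again a discrete `G`-module (the stabiliser of `f` contains the
finite intersection `⋂ₘ Stab_ρ(m) ∩ Stab_ω(f m)` of open stabilisers).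
Ref: Milne, *Arithmetic Duality Theorems* (2006), I §0 and I §2 (`M^D = Hom(M, μ)`); Serre,
*Cohomologie galoisienne*, II §5.1 (`A' = Hom(A, μ)`). [cite: MilneADT2006, I §0] -/
def homRep : ContinuousRep G ℤ (HomCarrier M Ω) :=
  ContinuousRep.ofStabilizerMemNhdsOne (homRepresentation ρ ω) fun f => by
    have h : ∀ m : M, ∀ᶠ σ in 𝓝 (1 : G), ρ σ m = m ∧ ω σ (f m) = f m := fun m =>
      Filter.Eventually.and (ρ.setOf_apply_eq_mem_nhds_one m) (ω.setOf_apply_eq_mem_nhds_one (f m))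
    filter_upwards [Filter.eventually_all.2 h] with σ hσ
    refine HomCarrier.ext fun m => ?_
    have h1 : ρ σ⁻¹ m = m := by
      conv_lhs => rw [← (hσ m).1]
      rw [← Module.End.mul_apply, ← map_mul, inv_mul_cancel, map_one, Module.End.one_apply]
    rw [homRepresentation_apply_apply_apply, h1, (hσ m).2]

/-- Unfolding the dual module. [folklore] -/
@[simp] theorem homRep_apply_apply_apply (σ : G) (f : HomCarrier M Ω) (m : M) :
    ρ.homRep ω σ f m = ω σ (f (ρ σ⁻¹ m)) := rfl

/-- A `G`-fixed element of `M^D` is an equivariant map. [folklore] -/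
theorem homRep_apply_eq_self_iff (σ : G) (f : HomCarrier M Ω) :
    ρ.homRep ω σ f = f ↔ ∀ m, ω σ (f m) = f (ρ σ m) := by
  constructor
  · intro h m
    have := congrArg (fun g : HomCarrier M Ω => g (ρ σ m)) h
    simpa [← Module.End.mul_apply, ← map_mul] using this
  · intro h
    refine HomCarrier.ext fun m => ?_
    rw [homRep_apply_apply_apply, h, ← Module.End.mul_apply, ← map_mul, mul_inv_cancel, map_one,
      Module.End.one_apply]

/-- **The dual module commutes with restriction** along a continuous homomorphism `θ : H → G`.
[folklore] -/
theorem homRep_restrict {H : Type u} [Group H] [TopologicalSpace H] [ContinuousMul H]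
    (θ : H →ₜ* G) : (ρ.homRep ω).restrict θ = (ρ.restrict θ).homRep (ω.restrict θ) := by
  refine ContinuousRep.ext fun g => LinearMap.ext fun f => HomCarrier.ext fun m => ?_
  rw [ContinuousRep.restrict_apply, homRep_apply_apply_apply, homRep_apply_apply_apply,
    ContinuousRep.restrict_apply, ContinuousRep.restrict_apply, map_inv θ]

omit [TopologicalSpace M] [DiscreteTopology M] [TopologicalSpace Ω] [DiscreteTopology Ω] [Finite M] in
/-- `n Ω = 0 ⇒ n M^D = 0`. [folklore] -/
theorem nsmul_homCarrier_eq_zero {n : ℕ} (hΩ : ∀ x : Ω, n • x = 0) (f : HomCarrier M Ω) :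
    n • f = 0 :=
  HomCarrier.ext fun m => by rw [HomCarrier.nsmul_apply, hΩ, HomCarrier.zero_apply]

end HomRep

/-! ### Functoriality and the evaluation pairing -/

section Functorial

variable {G : Type u} [Group G] [TopologicalSpace G] [ContinuousMul G]
variable {M₁ : Type u} [AddCommGroup M₁] [TopologicalSpace M₁] [DiscreteTopology M₁] [Finite M₁]
variable {M₂ : Type u} [AddCommGroup M₂] [TopologicalSpace M₂] [DiscreteTopology M₂] [Finite M₂]
variable {Ω : Type u} [AddCommGroup Ω] [TopologicalSpace Ω] [DiscreteTopology Ω]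
variable {ρ₁ : ContinuousRep G ℤ M₁} {ρ₂ : ContinuousRep G ℤ M₂} (ω : ContinuousRep G ℤ Ω)

/-- **Contravariant functoriality of the dual**: an equivariant `φ : M₁ → M₂` induces
`φ^D : M₂^D → M₁^D`, `f ↦ f ∘ φ`. [cite: MilneADT2006, I §0] -/
def homRepMap (φ : ρ₁.toTopRep ⟶ ρ₂.toTopRep) : (ρ₂.homRep ω).toTopRep ⟶ (ρ₁.homRep ω).toTopRep :=
  TopRep.ofHom
    { toFun := fun f => HomCarrier.ofAddMonoidHom ((f : M₂ →+ Ω).comp φ.hom.toLinearMap.toAddMonoidHom)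
      map_add' := fun _ _ => rfl
      map_smul' := fun _ _ => rfl
      cont := continuous_of_discreteTopology
      isIntertwining' := fun σ => ContinuousLinearMap.ext fun f => HomCarrier.ext fun m => by
        change ω σ (f (ρ₂ σ⁻¹ (φ.hom m))) = ω σ (f (φ.hom (ρ₁ σ⁻¹ m)))
        rw [ContinuousRep.hom_comm_apply φ] }

/-- Unfolding `homRepMap`: `(φ^D f)(m) = f (φ m)`. [folklore] -/
@[simp] theorem homRepMap_hom_apply_apply (φ : ρ₁.toTopRep ⟶ ρ₂.toTopRep)
    (f : HomCarrier M₂ Ω) (m : M₁) : (homRepMap ω φ).hom f m = f (φ.hom m) := rfl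

variable (ρ₁) in
/-- **The evaluation pairing `M × M^D → Ω`, `(m, f) ↦ f m`**, a continuous equivariant pairing
(`⟨σ m, σ f⟩ = σ f(σ⁻¹ σ m) = σ ⟨m, f⟩`). [cite: MilneADT2006, I §0] -/
def evalPairing : ContPairing ρ₁.toTopRep (ρ₁.homRep ω).toTopRep ω.toTopRep :=
  ContPairing.ofDiscrete
    (LinearMap.mk₂ ℤ (fun (m : M₁) (f : HomCarrier M₁ Ω) => f m) (fun m m' f => map_add f m m')
      (fun c m f => map_zsmul f c m) (fun _ _ _ => rfl) (fun _ _ _ => rfl))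
    fun σ m f => by
      change ω σ (f (ρ₁ σ⁻¹ (ρ₁ σ m))) = ω σ (f m)
      rw [← Module.End.mul_apply, ← map_mul, inv_mul_cancel, map_one, Module.End.one_apply]

/-- Unfolding `evalPairing`. [folklore] -/
@[simp] theorem evalPairing_toLin_apply (m : M₁) (f : HomCarrier M₁ Ω) :
    (evalPairing ρ₁ ω).toLin m f = f m := rfl

/-- **Compatibility of the evaluation pairings with `φ` and `φ^D`**: `⟨φ m₁, f⟩₂ = ⟨m₁, φ^D f⟩₁`.
[folklore] -/
theorem evalPairing_homRepMap (φ : ρ₁.toTopRep ⟶ ρ₂.toTopRep) (m₁ : M₁) (f : HomCarrier M₂ Ω) :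
    (evalPairing ρ₂ ω).toLin (φ.hom m₁) f = (evalPairing ρ₁ ω).toLin m₁ ((homRepMap ω φ).hom f) :=
  rfl

end Functorial

/-! ### The dual short exact sequence of `0 → N → M → M/N → 0` -/

section DualSES

variable {G : Type u} [Group G] [TopologicalSpace G] [IsTopologicalGroup G]
variable {M : Type u} [AddCommGroup M] [TopologicalSpace M] [DiscreteTopology M] [Finite M]
variable {Ω : Type u} [AddCommGroup Ω] [TopologicalSpace Ω] [DiscreteTopology Ω]
variable (ρ : ContinuousRep G ℤ M) (ω : ContinuousRep G ℤ Ω)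
variable (N : Submodule ℤ M) (hN : ∀ g, N ≤ N.comap (ρ g))

/-- The quotient of a finite module is finite (instance for the dual of a quotient). [folklore] -/
instance finite_quotient : Finite (M ⧸ N) := Finite.of_surjective _ (Submodule.Quotient.mk_surjective N)

/-- **The dual of `0 → N → M → M/N → 0` is short exact**: `0 → (M/N)^D → M^D → N^D → 0`, for a
`G`-stable submodule `N` of a finite discrete module `M` killed by `n` and `Ω ≃ ℤ/n`.  Formal
except for the surjectivity of restriction `Hom(M, Ω) → Hom(N, Ω)`, which is the injectivity of
`ℤ/n` as a `ℤ/n`-module, proved by counting: the kernel is `Hom(M/N, Ω)`, and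
`|Hom(A, Ω)| = |A|` for `A = M, N, M/N` (`HomCarrier.natCard_eq`).
Ref: Milne, *Arithmetic Duality Theorems* (2006), I §0 (exactness of `M ↦ M^D` on finite
modules); Serre, *Cohomologie galoisienne*, II §5.2 (proof of Thm. 2, dévissage).
[cite: MilneADT2006, I §0] -/
theorem isSES_homRepMap_mkQ_subtype {n : ℕ} [NeZero n] (eΩ : Ω ≃+ ZMod n)
    (hM : ∀ m : M, n • m = 0) :
    IsSES (homRepMap ω (ρ.mkQHom N hN)) (homRepMap ω (subtypeHom ρ N hN)) where
  comp_eq_zero := by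
    ext f x
    change f (Submodule.Quotient.mk (x : M)) = 0
    rw [(Submodule.Quotient.mk_eq_zero N).2 x.2, map_zero]
  injective := fun f g hfg => HomCarrier.ext fun q => by
    induction q using Submodule.Quotient.induction_on with
    | _ m => exact congrArg (fun h : HomCarrier M Ω => h m) hfg
  exact_mid := fun f hf => by
    have hker : ∀ x ∈ N, f x = 0 := fun x hx => congrArg (fun h : HomCarrier N Ω => h ⟨x, hx⟩) hf
    refine ⟨HomCarrier.ofAddMonoidHom ((N.liftQ (f : M →+ Ω).toIntLinearMap
      (fun x hx => hker x hx)).toAddMonoidHom), HomCarrier.ext fun m => rfl⟩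
  surjective := by
    classical
    -- counting: `|M^D| = |M| = |M/N| · |N|`, kernel `≅ (M/N)^D`, so the image has `|N| = |N^D|` elements
    let R : HomCarrier M Ω →+ HomCarrier N Ω := (homRepMap ω (subtypeHom ρ N hN)).hom.toLinearMap.toAddMonoidHom
    change Surjective R
    have hN' : ∀ x : N, n • x = 0 := fun x => Subtype.ext (by simp [hM])
    have hQ' : ∀ q : M ⧸ N, n • q = 0 := fun q => by
      induction q using Submodule.Quotient.induction_on with
      | _ m =>
        change n • N.mkQ m = 0
        rw [← map_nsmul, hM, map_zero]
    have cM : Nat.card (HomCarrier M Ω) = Nat.card M := HomCarrier.natCard_eq eΩ hM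
    have cN : Nat.card (HomCarrier N Ω) = Nat.card N := HomCarrier.natCard_eq eΩ hN'
    have cQ : Nat.card (HomCarrier (M ⧸ N) Ω) = Nat.card (M ⧸ N) := HomCarrier.natCard_eq eΩ hQ'
    -- the kernel of `R` is the image of the injective map `(M/N)^D → M^D`
    have hker : Nat.card R.ker = Nat.card (M ⧸ N) := by
      rw [← cQ]
      refine (Nat.card_congr (Equiv.ofBijective (fun f : HomCarrier (M ⧸ N) Ω =>
        (⟨(homRepMap ω (ρ.mkQHom N hN)).hom f, ?_⟩ : R.ker)) ⟨?_, ?_⟩)).symm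
      · rw [AddMonoidHom.mem_ker]
        ext x
        change f (Submodule.Quotient.mk (x : M)) = 0
        rw [(Submodule.Quotient.mk_eq_zero N).2 x.2, map_zero]
      · intro f g hfg
        have := congrArg Subtype.val hfg
        exact HomCarrier.ext fun q => by
          induction q using Submodule.Quotient.induction_on with
          | _ m => exact congrArg (fun h : HomCarrier M Ω => h m) this
      · rintro ⟨f, hf⟩
        rw [AddMonoidHom.mem_ker] at hf
        have hk : ∀ x ∈ N, f x = 0 := fun x hx => congrArg (fun h : HomCarrier N Ω => h ⟨x, hx⟩) hf
        exact ⟨HomCarrier.ofAddMonoidHom ((N.liftQ (f : M →+ Ω).toIntLinearMap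
          (fun x hx => hk x hx)).toAddMonoidHom), Subtype.ext (HomCarrier.ext fun m => rfl)⟩
    -- `|M^D| = |ker R| · |range R|` and `|M| = |M/N| · |N|`
    have h1 : Nat.card (HomCarrier M Ω) = Nat.card R.range * Nat.card R.ker := by
      rw [← Nat.card_congr (QuotientAddGroup.quotientKerEquivRange R).toEquiv]
      exact AddSubgroup.card_eq_card_quotient_mul_card_addSubgroup R.ker
    have h2 : Nat.card M = Nat.card N * Nat.card (M ⧸ N) :=
      Submodule.card_eq_card_quotient_mul_card N
    rw [cM, hker, h2] at h1
    have hpos : 0 < Nat.card (M ⧸ N) := Nat.card_pos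
    have hrange : Nat.card R.range = Nat.card N := (Nat.eq_of_mul_eq_mul_right hpos h1).symm
    -- a subgroup of full cardinality is everything
    haveI : Finite (HomCarrier N Ω) := Nat.finite_of_card_ne_zero (by rw [cN]; exact Nat.card_pos.ne')
    have htop : R.range = ⊤ := AddSubgroup.eq_top_of_card_eq _ (by rw [hrange, ← cN])
    exact AddMonoidHom.range_eq_top.1 htop

/-- **Compatibility of the three evaluation pairings with the maps of the two short exact
sequences** (hypotheses `hc₁`, `hc₂` of `cupProduct_δ₀_eq_neg_map_δ₁`):
`⟨ι x, f⟩_M = ⟨x, f ∘ ι⟩_N` and `⟨m, h ∘ π⟩_M = ⟨π m, h⟩_{M/N}`. [folklore] -/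
theorem evalPairing_compat :
    (∀ (x : N) (f : HomCarrier M Ω), (evalPairing ρ ω).toLin ((subtypeHom ρ N hN).hom x) f =
      (evalPairing (ρ.subrepresentation N hN) ω).toLin x
        ((homRepMap ω (subtypeHom ρ N hN)).hom f)) ∧
    (∀ (m : M) (h : HomCarrier (M ⧸ N) Ω), (evalPairing ρ ω).toLin m
      ((homRepMap ω (ρ.mkQHom N hN)).hom h) =
      (evalPairing (ρ.quotient N hN) ω).toLin ((ρ.mkQHom N hN).hom m) h) :=
  ⟨fun _ _ => rfl, fun _ _ => rfl⟩

end DualSES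

end ContinuousRep

/-! ### The tree's Tate dual is the dual module for `Ω = μₙ(K̄)` -/

namespace DiscreteGaloisModule

variable {K : Type u} [Field K] {M : Type u} [AddCommGroup M] [TopologicalSpace M]
  [DiscreteTopology M] [Finite M]

/-- **`M^∨(1) = Hom(M, μₙ)` is `ContinuousRep.homRep` for `Ω = μₙ(K̄)`**: the tree's Tate dual
`ρ.tateDual n` and `ρ.homRep (mu K n)` act by the same formula `(σ f)(m) = σ f(σ⁻¹ m)` on the same
carrier `M →+ μₙ(K̄)`. [cite: MilneADT2006, I §2] -/
theorem tateDual_apply_eq_homRep_apply (ρ : DiscreteGaloisModule K M) (n : ℕ)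
    (σ : Field.absoluteGaloisGroup K) (f : TateDual K M n) (m : M) :
    ρ.tateDual n σ f m = (ContinuousRep.homRep ρ (mu K n)) σ (HomCarrier.ofAddMonoidHom f) m := rfl

end DiscreteGaloisModule

end Literature.NumberTheory.GaloisRepresentations

end
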